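import Mathlib
import HarnessLib
import Summits.HubbardSuperconductivity.HubbardSuperconductivity.Theorems.KLProgrammeSWaveCascadeVarying

/-!
# Route `KLProgramme` — bridge from p1's matrix form of (E2-v2) (`PairLadderStepAt`: right inverse of `1 + diag(w)·𝒞`,
# entrywise tolerance, arrays supported on the ball) to the implicit weighted-product step of `sWaveCascade_envelope_varying`

Cell gate-hubbard-kl, seat p3 (row 0′ of the K3 supplier map).  Three mechanical facts the wrapper
`pairArrayAt_of_pairLadderSteps` (next) consumes:

* `mul_diagonal_mul_apply_eq_wmul` — `(A · diagonal w · B) s t = (A ∗_w B) s t` (Mathlib's matrix product with a diagonal middle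
  factor IS the weighted product `wmul` of `KLProgrammeSWaveCascadeDefs`);
* **`implicit_step_of_rightInverse`** — if `(1 + diagonal w · 𝒞) · N = 1` (p1's `∃ N`) and `𝒞' = 𝒞 · N + Δ`, then
  `𝒞' = 𝒞 - 𝒞' · diagonal w · 𝒞 + (Δ + Δ · diagonal w · 𝒞)` — the implicit cascade step with tail `T = Δ + Δ ∗_w 𝒞` (a right inverse
  of a square matrix is two-sided, `Matrix.mul_eq_one_comm`);
* `resArr_wmul` — restriction to a finite index set `B` (the ball) commutes with the weighted product when the right factor is
  supported on `B` in its first index (`klPairArray` is supported on `klBall × klBall`), `resArr_add/_sub/_smul/_onesArr`-type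
  bookkeeping, and `esup_resArr_le_of_forall` (an entrywise bound on `B × B` bounds `esup` of the restriction).

Everything is proved; no definitions.
-/

noncomputable section

namespace Summit.HubbardSuperconductivity.HubbardSuperconductivity.Theorems.SWaveCascade

set_option linter.dupNamespace false -- summit = problem name (single-conjunct summit), D-0017

open Finset

variable {S : Type*} [Fintype S] [DecidableEq S]

/-- **Matrix product with a diagonal middle factor = the weighted product**: `(A · diagonal w · B) s t = (A ∗_w B) s t`. -/
theorem mul_diagonal_mul_apply_eq_wmul (w : S → ℝ) (A B : Matrix S S ℂ) (s t : S) :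
    (A * Matrix.diagonal (fun p => (w p : ℂ)) * B) s t = wmul w A B s t := by
  rw [Matrix.mul_apply]
  simp only [Matrix.mul_diagonal, wmul]

/-- The same as an identity of arrays. -/
theorem mul_diagonal_mul_eq_wmul (w : S → ℝ) (A B : Matrix S S ℂ) :
    (A * Matrix.diagonal (fun p => (w p : ℂ)) * B : S → S → ℂ) = wmul w A B := by
  funext s t; exact mul_diagonal_mul_apply_eq_wmul w A B s t

/-- **From p1's right inverse to the implicit cascade step.**  If `(1 + diagonal w · 𝒞) · N = 1` and `𝒞' = 𝒞 · N + Δ` then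
`𝒞' = 𝒞 - 𝒞' · diagonal w · 𝒞 + (Δ + Δ · diagonal w · 𝒞)`. -/
theorem implicit_step_of_rightInverse (w : S → ℝ) {𝒞 𝒞' N Δ : Matrix S S ℂ}
    (hN : (1 + Matrix.diagonal (fun p => (w p : ℂ)) * 𝒞) * N = 1) (hΔ : 𝒞' = 𝒞 * N + Δ) :
    𝒞' = 𝒞 - 𝒞' * Matrix.diagonal (fun p => (w p : ℂ)) * 𝒞 + (Δ + Δ * Matrix.diagonal (fun p => (w p : ℂ)) * 𝒞) := by
  set D : Matrix S S ℂ := Matrix.diagonal (fun p => (w p : ℂ)) with hD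
  have hN' : N * (1 + D * 𝒞) = 1 := mul_eq_one_comm.1 hN
  have h1 : 𝒞' * (1 + D * 𝒞) = 𝒞 + Δ * (1 + D * 𝒞) := by
    rw [hΔ, add_mul, Matrix.mul_assoc, hN', Matrix.mul_one]
  have h2 : 𝒞' + 𝒞' * D * 𝒞 = 𝒞 + (Δ + Δ * D * 𝒞) := by
    have := h1
    rw [mul_add, mul_one, mul_add, mul_one, ← Matrix.mul_assoc, ← Matrix.mul_assoc] at this
    exact this
  rw [← sub_eq_zero]
  have e : 𝒞' - (𝒞 - 𝒞' * D * 𝒞 + (Δ + Δ * D * 𝒞)) = (𝒞' + 𝒞' * D * 𝒞) - (𝒞 + (Δ + Δ * D * 𝒞)) := by abel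
  rw [e, h2, sub_self]

/-! ### Restriction to a finite index set -/

omit [Fintype S] [DecidableEq S] in
/-- Restriction is additive. -/
theorem resArr_add (B : Finset S) (A C : S → S → ℂ) : resArr B (A + C) = resArr B A + resArr B C := rfl

omit [Fintype S] [DecidableEq S] in
/-- Restriction is subtractive. -/
theorem resArr_sub (B : Finset S) (A C : S → S → ℂ) : resArr B (A - C) = resArr B A - resArr B C := rfl

omit [Fintype S] [DecidableEq S] in
/-- Restriction commutes with scalars. -/
theorem resArr_smul (B : Finset S) (c : ℂ) (A : S → S → ℂ) : resArr B (c • A) = c • resArr B A := rfl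

omit [Fintype S] [DecidableEq S] in
/-- Restriction of the all-ones array is the all-ones array of the sub-carrier. -/
theorem resArr_onesArr (B : Finset S) : resArr B (onesArr : S → S → ℂ) = onesArr := rfl

omit [DecidableEq S] in
/-- **Restriction commutes with the weighted product** when the right factor is supported on `B` in its first index
(the sum over the middle index reduces to `B`). -/
theorem resArr_wmul (B : Finset S) (w : S → ℝ) (A C : S → S → ℂ) (hC : ∀ u, u ∉ B → ∀ t, C u t = 0) :
    resArr B (wmul w A C) = wmul (fun u : ↥B => w u.1) (resArr B A) (resArr B C) := by
  funext k k'
  simp only [resArr, wmul]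
  have h1 : ∑ u, A k.1 u * (w u : ℂ) * C u k'.1 = ∑ u ∈ B, A k.1 u * (w u : ℂ) * C u k'.1 :=
    (Finset.sum_subset (Finset.subset_univ B) fun u _ hu => by rw [hC u hu, mul_zero]).symm
  rw [h1, ← Finset.sum_coe_sort]

omit [Fintype S] [DecidableEq S] in
/-- An entrywise bound on `B × B` bounds the max-entry size of the restriction. -/
theorem esup_resArr_le_of_forall (B : Finset S) {A : S → S → ℂ} {x : ℝ} (hx : 0 ≤ x)
    (h : ∀ k ∈ B, ∀ k' ∈ B, ‖A k k'‖ ≤ x) : esup (resArr B A) ≤ x :=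
  esup_le (fun k k' => h k.1 k.2 k'.1 k'.2) hx

omit [Fintype S] [DecidableEq S] in
/-- Conversely the max-entry size of the restriction bounds every entry on `B × B`. -/
theorem norm_le_esup_resArr (B : Finset S) (A : S → S → ℂ) {k k' : S} (hk : k ∈ B) (hk' : k' ∈ B) :
    ‖A k k'‖ ≤ esup (resArr B A) :=
  le_esup (resArr B A) ⟨k, hk⟩ ⟨k', hk'⟩

end Summit.HubbardSuperconductivity.HubbardSuperconductivity.Theorems.SWaveCascade

end
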